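import Summits.Ventures.PercRepro.MSRMStarSetup

/-!
# (RM*): the anatomy of a counterexample

Setting `RMStar r F u₀` (`MSRMStarSetup.lean`). A *counterexample* is an instance in which some
nonempty `r`-lifted face is not a member avoiding `r`. By the one-sided trace reduction
(`partr_subset_insert_empty_of_sided`, Addendum 28 (R3)) a counterexample has an `r`-only
singleton on both sides: some `y₀ ∈ u₀` and some `z₀ ∈ ū` with `{y₀}, {z₀} ∉ F₀`
(`exists_ronly_mem_u0`, `exists_ronly_mem_ubar`). Everything below is stated for such `y₀`, `z₀`
(Addendum 35, "imported facts" and Claim 1, with the precision note):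

* `ū` is not a face (`ubar_notMem_proj`); the A-only difference `u₀ ∖ s*` is partnerless
  (`sdiff_partnerless`), so `s*` avoids every `r`-only element of `u₀` and is a partner member
  (`aonly_mem_partner`); every member singleton is a partner member
  (`singleton_mem_partner_of_mem_part0`);
* **Claim 1**: no partnerless member is a proper subset of `u₀` (`mem_partr_of_ssubset`) — a
  proper subset `p` misses a member singleton `{x}`, the face `X = u₀ ∖ p ∋ x` is a member by the
  up-set, (H3) at `X` gives `p = u₀ ∖ X ∈ Y ⊆ F₁`; hence `s* ⊆ ū` (`aonly_subset_ubar`);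
* for a partner member `k ⊆ ū`, `ū ∖ k` is a type-I difference (`sdiff_mem_diffsY_of_subset_ubar`);
  every singleton `{x}`, `x ≠ r`, is a type-I difference (`singleton_mem_diffsY`: `{x}` is
  `r`-lifted, and `s* ⊆ ū` or `q_{z₀} = u₀ ∩ R_{z₀} ⊆ u₀` is a partner member avoiding `x`);
* the bookkeeping `|Y| = |K| + 1`, `D(K) ⊆ Y` (`diffs_partner_subset_diffsY`): either `K` has
  excess one and `Y = D(K)`, or `K` is tight and `Y = D(K) ⊔ {e₀}` (`diffsY_cases`).
-/

namespace PercRepro.MSTight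

open Finset
open scoped FinsetFamily

variable {α : Type*} [DecidableEq α] [Fintype α]

namespace RMStar

variable {r : α} {F : Finset (Finset α)} {u₀ : Finset α}

/-- **(R3), the `u₀` side.** A counterexample has an `r`-only element inside `u₀`. -/
theorem exists_ronly_mem_u0 (h : RMStar r F u₀) (hcex : ¬ partr r F ⊆ insert ∅ (part0 r F)) :
    ∃ y ∈ u₀, ({y} : Finset α) ∉ part0 r F := by
  by_contra hcon
  refine hcex (h.partr_subset_of_u0_sided fun y hy => ?_)
  by_contra hy0
  exact hcon ⟨y, hy, hy0⟩

/-- **(R3), the `ū` side.** A counterexample has an `r`-only element inside `ū`. -/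
theorem exists_ronly_mem_ubar (h : RMStar r F u₀) (hcex : ¬ partr r F ⊆ insert ∅ (part0 r F)) :
    ∃ z ∈ ubar r u₀, ({z} : Finset α) ∉ part0 r F := by
  by_contra hcon
  refine hcex (h.partr_subset_of_ubar_sided fun z hz => ?_)
  by_contra hz0
  exact hcon ⟨z, hz, hz0⟩

/-- `ū` is not a face of the trace: it is not `r`-lifted, and a partnerless `ū` would contain
the `r`-only `y₀ ∈ u₀`. -/
theorem ubar_notMem_proj (h : RMStar r F u₀) {y₀ : α} (hy₀ : y₀ ∈ u₀)
    (hy₀0 : ({y₀} : Finset α) ∉ part0 r F) : ubar r u₀ ∉ proj r F := by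
  intro hP
  rcases part0_or_partr hP with h0 | h1
  · have := h.mem_of_partnerless hy₀ hy₀0 h0 h.ubar_notMem
    exact (mem_ubar.1 this).2 hy₀
  · exact h.ubar_notMem h1

/-- The A-only difference `u₀ ∖ s` is a partnerless member: it is a face, and if it were
`r`-lifted it would be the type-I difference `(u₀ ∖ s) ∖ s`. -/
theorem sdiff_partnerless (h : RMStar r F u₀) {s : Finset α} (hs : s ∈ part0 r F)
    (hs4 : u₀ \ s ∉ diffsY r F) : u₀ \ s ∈ part0 r F ∧ u₀ \ s ∉ partr r F := by
  have hP : u₀ \ s ∈ proj r F := h.mem_proj_of_subset' h.u0_mem_proj sdiff_subset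
  have h1 : u₀ \ s ∉ partr r F := fun h1 =>
    hs4 (mem_diffsY_of_disjoint h1 hs sdiff_disjoint)
  exact ⟨(part0_or_partr hP).resolve_right h1, h1⟩

/-- An A-only member avoids every `r`-only element of `u₀` (which lies in the partnerless
`u₀ ∖ s`). -/
theorem notMem_aonly (h : RMStar r F u₀) {y : α} (hy : y ∈ u₀)
    (hy0 : ({y} : Finset α) ∉ part0 r F) {s : Finset α} (hs : s ∈ part0 r F)
    (hs4 : u₀ \ s ∉ diffsY r F) : y ∉ s := by
  obtain ⟨h0, h1⟩ := h.sdiff_partnerless hs hs4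
  exact (mem_sdiff.1 (h.mem_of_partnerless hy hy0 h0 h1)).2

/-- An A-only member is a partner member (Lemma 2 at an `r`-only `y₀ ∈ u₀`, which it avoids). -/
theorem aonly_mem_partner (h : RMStar r F u₀) {y₀ : α} (hy₀ : y₀ ∈ u₀)
    (hy₀0 : ({y₀} : Finset α) ∉ part0 r F) {s : Finset α} (hs : s ∈ part0 r F)
    (hs4 : u₀ \ s ∉ diffsY r F) : s ∈ partner r F := by
  have hyr : y₀ ≠ r := fun e => h.r_notMem_u0 (e ▸ hy₀)
  have hys := h.notMem_aonly hy₀ hy₀0 hs hs4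
  exact mem_inter.2 ⟨hs,
    h.mem_partr_of_tight_of_notMem hyr hy₀0 (h.tight_proj_of_mem_u0 hy₀ hy₀0) hs hys⟩

/-- Every member singleton is a partner member: a partnerless `{x}` would contain the `r`-only
`y₀`, i.e. `x = y₀`. -/
theorem singleton_mem_partner_of_mem_part0 (h : RMStar r F u₀) {y₀ : α} (hy₀ : y₀ ∈ u₀)
    (hy₀0 : ({y₀} : Finset α) ∉ part0 r F) {x : α} (hx : ({x} : Finset α) ∈ part0 r F) :
    ({x} : Finset α) ∈ partner r F := by
  refine mem_inter.2 ⟨hx, ?_⟩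
  by_contra h1
  have := h.mem_of_partnerless hy₀ hy₀0 hx h1
  rw [mem_singleton] at this
  subst this
  exact hy₀0 hx

/-- **Claim 1.** No partnerless member is a proper subset of `u₀`. -/
theorem mem_partr_of_ssubset (h : RMStar r F u₀) {y₀ : α} (hy₀ : y₀ ∈ u₀)
    (hy₀0 : ({y₀} : Finset α) ∉ part0 r F) {p : Finset α} (hp : p ⊂ u₀)
    (hp0 : p ∈ part0 r F) : p ∈ partr r F := by
  by_contra hp1
  obtain ⟨hpsub, hpne⟩ := Finset.ssubset_iff_subset_ne.1 hp
  have hX : (u₀ \ p).Nonempty := by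
    rw [nonempty_iff_ne_empty]
    intro hXe
    rw [sdiff_eq_empty_iff_subset] at hXe
    exact hpne (Subset.antisymm hpsub hXe)
  obtain ⟨x, hx⟩ := hX
  have hxu : x ∈ u₀ := (mem_sdiff.1 hx).1
  have hxp : x ∉ p := (mem_sdiff.1 hx).2
  -- `x` is not `r`-only (else it would lie in the partnerless `p`), so `{x}` is a member
  have hx0 : ({x} : Finset α) ∈ part0 r F := by
    by_contra hx0
    exact hxp (h.mem_of_partnerless hxu hx0 hp0 hp1)
  -- `X = u₀ ∖ p` is a member avoiding `r` (up-set)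
  have hXP : u₀ \ p ∈ proj r F := h.mem_proj_of_subset' h.u0_mem_proj sdiff_subset
  have hX0 : u₀ \ p ∈ part0 r F := h.up _ hx0 _ hXP (singleton_subset_iff.2 hx)
  -- (H3) at `X`
  rcases h.signable _ hX0 with hA | hC
  · have hd : Disjoint (ubar r u₀) (u₀ \ p) :=
      Finset.disjoint_of_subset_right sdiff_subset (disjoint_ubar r u₀)
    rw [sdiff_eq_self_of_disjoint hd] at hA
    exact h.ubar_notMem_proj hy₀ hy₀0 hA
  · rw [Finset.sdiff_sdiff_eq_self hpsub] at hC
    exact hp1 (h.diffsY_subset hC)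

/-- An A-only member lies inside `ū`: `u₀ ∖ s*` is partnerless, hence not a proper subset of
`u₀` (Claim 1), hence `u₀ ∖ s* = u₀`. -/
theorem aonly_subset_ubar (h : RMStar r F u₀) {y₀ : α} (hy₀ : y₀ ∈ u₀)
    (hy₀0 : ({y₀} : Finset α) ∉ part0 r F) {s : Finset α} (hs : s ∈ part0 r F)
    (hs4 : u₀ \ s ∉ diffsY r F) : s ⊆ ubar r u₀ := by
  obtain ⟨h0, h1⟩ := h.sdiff_partnerless hs hs4
  have heq : u₀ \ s = u₀ := by
    by_contra hne
    have hss : u₀ \ s ⊂ u₀ := Finset.ssubset_iff_subset_ne.2 ⟨sdiff_subset, hne⟩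
    exact h1 (h.mem_partr_of_ssubset hy₀ hy₀0 hss h0)
  intro a ha
  rw [mem_ubar]
  refine ⟨fun har => (mem_part0.1 hs).2 (har ▸ ha), fun hau => ?_⟩
  have : a ∈ u₀ \ s := by rw [heq]; exact hau
  exact (mem_sdiff.1 this).2 ha

/-- For a partner member `k ⊆ ū`, `ū ∖ k` is a type-I difference: (H3) at `k` gives `ū ∖ k ∈ P`
(`u₀ ∖ k = u₀` is not), the face `ū ∖ k` avoids `y₀` so it is not partnerless, and it is
disjoint from `k`. -/
theorem sdiff_mem_diffsY_of_subset_ubar (h : RMStar r F u₀) {y₀ : α} (hy₀ : y₀ ∈ u₀)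
    (hy₀0 : ({y₀} : Finset α) ∉ part0 r F) {k : Finset α} (hk : k ∈ partner r F)
    (hk' : k ⊆ ubar r u₀) : ubar r u₀ \ k ∈ diffsY r F := by
  have hk0 : k ∈ part0 r F := (mem_inter.1 hk).1
  rcases h.signable k hk0 with hA | hC
  · rcases part0_or_partr hA with h0 | h1
    · by_cases h1 : ubar r u₀ \ k ∈ partr r F
      · exact mem_diffsY_of_disjoint h1 hk0 sdiff_disjoint
      · exfalso
        have := h.mem_of_partnerless hy₀ hy₀0 h0 h1
        exact (mem_ubar.1 (mem_sdiff.1 this).1).2 hy₀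
    · exact mem_diffsY_of_disjoint h1 hk0 sdiff_disjoint
  · exfalso
    have hd : Disjoint u₀ k :=
      Finset.disjoint_of_subset_right hk' (disjoint_ubar r u₀).symm
    rw [sdiff_eq_self_of_disjoint hd] at hC
    exact h.u0_notMem_diffsY hC

/-- Every singleton `{x}`, `x ≠ r`, is a type-I difference: it is `r`-lifted (an `r`-only
singleton directly, a member singleton as a partner member), and a partner member avoiding `x`
exists — `s* ⊆ ū` when `x ∈ u₀`, `q_{z₀} ⊆ u₀` when `x ∉ u₀`. -/
theorem singleton_mem_diffsY (h : RMStar r F u₀) {y₀ : α} (hy₀ : y₀ ∈ u₀)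
    (hy₀0 : ({y₀} : Finset α) ∉ part0 r F) {z₀ : α} (hz₀ : z₀ ∈ ubar r u₀)
    (hz₀0 : ({z₀} : Finset α) ∉ part0 r F) {s : Finset α} (hs : s ∈ part0 r F)
    (hs4 : u₀ \ s ∉ diffsY r F) {x : α} (hx : x ≠ r) : ({x} : Finset α) ∈ diffsY r F := by
  have hx1 : ({x} : Finset α) ∈ partr r F := by
    by_cases hx0 : ({x} : Finset α) ∈ part0 r F
    · exact (mem_inter.1 (h.singleton_mem_partner_of_mem_part0 hy₀ hy₀0 hx0)).2
    · exact h.singleton_mem_partr hx hx0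
  by_cases hxu : x ∈ u₀
  · have hs' := h.aonly_mem_partner hy₀ hy₀0 hs hs4
    have hxs : x ∉ s := fun hxs =>
      (mem_ubar.1 (h.aonly_subset_ubar hy₀ hy₀0 hs hs4 hxs)).2 hxu
    exact mem_diffsY_of_disjoint hx1 (mem_inter.1 hs').1 (disjoint_singleton_left.2 hxs)
  · have hq := h.inter_u0_Rstar_mem_partner hz₀ hz₀0
    have hxq : x ∉ u₀ ∩ Rstar (partner z₀ F) := fun hxq => hxu (mem_inter.1 hxq).1
    exact mem_diffsY_of_disjoint hx1 (mem_inter.1 hq).1 (disjoint_singleton_left.2 hxq)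

/-! ### The bookkeeping `|Y| = |K| + 1`, `D(K) ⊆ Y` -/

/-- The differences of the partner family are type-I differences. -/
theorem diffs_partner_subset_diffsY (h : RMStar r F u₀) :
    partner r F \\ partner r F ⊆ diffsY r F := by
  have _ := h.exc
  intro E hE
  obtain ⟨a, ha, b, hb, rfl⟩ := Finset.mem_diffs.1 hE
  exact Finset.sdiff_mem_diffs (mem_inter.1 ha).2 (mem_inter.1 hb).1

/-- **The two cases of a counterexample.** Either the partner family has excess one and
`Y = D(K)`, or it is tight and `Y = D(K) ⊔ {e₀}` for a single `e₀ ∉ D(K)`. -/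
theorem diffsY_cases (h : RMStar r F u₀) :
    ((partner r F \\ partner r F).card = (partner r F).card + 1 ∧
        diffsY r F = partner r F \\ partner r F) ∨
      (Tight (partner r F) ∧ ∃ e₀ ∈ diffsY r F, e₀ ∉ partner r F \\ partner r F ∧
        diffsY r F = insert e₀ (partner r F \\ partner r F)) := by
  have hsub := h.diffs_partner_subset_diffsY
  have hc := h.card_diffsY
  have hMS := Finset.card_le_card_diffs (partner r F)
  have hle := card_le_card hsub
  rcases Nat.lt_or_ge (partner r F).card (partner r F \\ partner r F).card with hlt | hge
  · left
    have h1 : (partner r F \\ partner r F).card = (partner r F).card + 1 := by omega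
    exact ⟨h1, (eq_of_subset_of_card_le hsub (by omega)).symm⟩
  · right
    have hT : Tight (partner r F) := by unfold Tight; omega
    refine ⟨hT, ?_⟩
    have hcard : (diffsY r F \ (partner r F \\ partner r F)).card = 1 := by
      have := card_sdiff_add_card_eq_card hsub
      unfold Tight at hT
      omega
    obtain ⟨e₀, he₀⟩ := card_eq_one.1 hcard
    have he₀' : e₀ ∈ diffsY r F \ (partner r F \\ partner r F) := by
      rw [he₀]; exact mem_singleton_self _
    refine ⟨e₀, (mem_sdiff.1 he₀').1, (mem_sdiff.1 he₀').2, ?_⟩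
    ext E
    constructor
    · intro hE
      by_cases hD : E ∈ partner r F \\ partner r F
      · exact mem_insert_of_mem hD
      · have : E ∈ diffsY r F \ (partner r F \\ partner r F) := mem_sdiff.2 ⟨hE, hD⟩
        rw [he₀] at this
        exact mem_insert.2 (Or.inl (mem_singleton.1 this))
    · intro hE
      rcases mem_insert.1 hE with rfl | hE
      · exact (mem_sdiff.1 he₀').1
      · exact hsub hE

end RMStar

end PercRepro.MSTight
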